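import Mathlib
import Summits.QuantumFields.QCD.Theorems.PauliWegnerSeaPhaseQuenchedFlavourDecayDoubletMinorSquareWick
import Literature.MathematicalPhysics.QuantumFieldTheory.QCDObservableProduct

/-!
# Stub `stub_doubletMinorSecondMoment_of_crux` of line `crossing-split-integrability`
(crux `Summit.QuantumFields.QCD.Theses.PauliWegnerSea.PhaseQuenchedFlavourDecay` =
`Summit.QuantumFields.QCD.Theses.WilsonMobilityGap.PhaseQuenchedFlavourDecay`, item stmt-QuantumFields-9151)

**RANK-`r` NECESSITY: the crux contains the uniform bound and the `e₀`-decay of the phase-quenched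
SECOND MOMENTS of ALL `r × r` Wick minors of a doubled flavour.**  For every flavour `f` with a
mass-degenerate partner `g ≠ f`, every rank `r ≥ 1`, every quark box `R` and all site tuples
`x, y : Fin r → box R`, the crux applied to the flavour-charged multi-meson pair
`A = Π_a (ψ̄_g γ₅ ψ_f)(x_a)` (charge `+r` under `U(1)_f`) and `B = Π_b (ψ̄_f γ₅ ψ_g)(y_b)` gives,
eventually in `k` and for all `S ≥ L_k`, `n ≤ S`,
`Σ_{colour–spin choices P, Q} E₊ |det[G_f((x_a,P_a),(y_b + n e₀,Q_b))]_{a,b}|² ≤ C' e^{-δ' a_k n}`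
with the crux's own rate `δ'` — the `r = 1` case is `stub_pionSecondMomentDecay_of_crux` (p124062).
So the `ε = 1`, single-member, time-separated slices of the open core `UniformMinorMoments` are
NECESSARY for the crux at EVERY rank (a rank-`r` tilted Minami-type second-moment statement), not
only at `r = 1`.

Ingredients: the product observables (`QCDLatticeObservable` is a monoid:
`Literature/…/QCDObservableProduct.lean`; charges add, placement is multiplicative), the
non-commutative expansion of an ordered product of sums (`ofFn_prod_sum`), and the configuration-wise
rank-`r` Wick identity `stub_doubletMinorSquare_wick` (p142089):
`⟨Π_a ψ̄_g(I_a)ψ_f(I_a) · Π_b ψ̄_f(J_b)ψ_g(J_b)⟩_F = σ_r Πε(I) Πε(J) |det G_f[I,J]|²`; the `γ₅`-signs of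
the two expansions square to `1`, so the Berezin ratio of `A(0)B(n e₀)` is `σ_r Σ_{P,Q} |det|²` in every
background (junk-consistent: for `det D = 0` both sides vanish since `r ≥ 1`).

Sources: I. Montvay, G. Münster, *Quantum Fields on a Lattice* (CUP 1994), §4.1.3 (4.25) (Wick rule),
§5.1.2 (5.15) (γ₅-hermiticity), §5.1.1 (5.6) (flavour symmetry).
-/

noncomputable section

namespace Summit.QuantumFields.QCD.Cruxes.PhaseQuenchedFlavourDecay.CrossingSplitIntegrability

open scoped BigOperators
open MeasureTheory Filter
open Literature.MathematicalPhysics.QuantumFieldTheory Literature.MathematicalPhysics.QuantumLattice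
  Literature.Probability.LatticeModels

/-! ### Algebra: ordered products of sums and of scalar multiples -/

/-- **Non-commutative expansion of an ordered product of finite sums**:
`Π_a (Σ_i t_a(i)) = Σ_{P : Fin r → ι} Π_a t_a(P_a)` (ordered `List` products in any semiring). -/
theorem ofFn_prod_sum {A : Type*} [Semiring A] {ι : Type*} [Fintype ι] :
    ∀ {r : ℕ} (t : Fin r → ι → A),
      (List.ofFn fun a => ∑ i, t a i).prod = ∑ P : Fin r → ι, (List.ofFn fun a => t a (P a)).prod
  | 0, t => by simp
  | r + 1, t => by
    rw [List.ofFn_succ, List.prod_cons, ofFn_prod_sum (fun a => t a.succ), Finset.sum_mul_sum,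
      ← Fintype.sum_prod_type']
    refine Fintype.sum_equiv (Fin.consEquiv fun _ : Fin (r + 1) => ι) _ _ fun q => ?_
    rw [List.ofFn_succ, List.prod_cons]
    simp only [Fin.consEquiv_apply, Fin.cons_zero, Fin.cons_succ]

/-- An ordered product of scalar multiples: `Π_a (c_a • w_a) = (Π_a c_a) • Π_a w_a`. -/
theorem ofFn_prod_smul {A : Type*} [Ring A] [Algebra ℂ A] :
    ∀ {r : ℕ} (c : Fin r → ℂ) (w : Fin r → A),
      (List.ofFn fun a => c a • w a).prod = (∏ a, c a) • (List.ofFn fun a => w a).prod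
  | 0, c, w => by simp
  | r + 1, c, w => by
    rw [List.ofFn_succ, List.prod_cons, ofFn_prod_smul (fun a => c a.succ) (fun a => w a.succ),
      List.ofFn_succ, List.prod_cons, Fin.prod_univ_succ, smul_mul_smul_comm]

/-- The product of `γ₅`-signs squares to one: `(Π_a ε(α_a))² = 1`. -/
theorem prod_gammaFiveSign_mul_self {r : ℕ} (α : Fin r → Fin 4) :
    (∏ a, (![1, 1, -1, -1] : Fin 4 → ℂ) (α a)) * ∏ a, (![1, 1, -1, -1] : Fin 4 → ℂ) (α a) = 1 := by
  rw [← Finset.prod_mul_distrib]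
  exact Finset.prod_eq_one fun a _ => gammaFiveSign_mul_self (α a)

/-! ### The flavoured pseudoscalar density at a box site -/

/-- **`(ψ̄_g γ₅ ψ_f)(x)` has `U(1)_f` charge `+1`** (`f ≠ g`; any site `x` of the box). -/
theorem isFlavourCharged_localBilinearObs_single {Nf R : ℕ} (x : ↥(box 4 R)) {f g : Fin Nf}
    (hfg : f ≠ g) :
    (localBilinearObs Nf x (Matrix.single g f (1 : ℂ)) gammaFive).IsFlavourCharged f 1 := by
  intro θ U
  have hgf : ¬(g = f) := Ne.symm hfg
  rw [localBilinearObs_F]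
  simp only [Matrix.single_apply, ite_and, ite_smul, one_smul, zero_smul, Finset.sum_ite_irrel,
    Finset.sum_const_zero, Finset.sum_ite_eq, Finset.mem_univ, if_true]
  simp only [boxBilinear, map_sum, map_smul, map_mul, boxQbar, boxQ, fermiFlavourPhase_psiBar,
    fermiFlavourPhase_psi, Equiv.symm_apply_apply, hgf, if_false, if_true, one_smul, mul_smul_comm,
    Finset.smul_sum, smul_smul]
  refine Finset.sum_congr rfl fun α _ => Finset.sum_congr rfl fun β _ =>
    Finset.sum_congr rfl fun a _ => Finset.sum_congr rfl fun b _ => ?_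
  congr 1
  push_cast
  ring

/-- **`(ψ̄_g γ₅ ψ_f)(x)` placed at `v` on the torus** is the `γ₅`-signed colour–spin sum
`Σ_{c,α} ε_α ψ̄_{g,(x+v,c,α)} ψ_{f,(x+v,c,α)}` (as a sum over the pairs `(c, α)`). -/
theorem localBilinearObs_single_onTorus_eq_sum {Nf R S : ℕ} [NeZero S] (x : ↥(box 4 R))
    (f g : Fin Nf) (v : Literature.Probability.LatticeModels.Site 4) (U : GaugeConfig 4 S SU3) :
    (localBilinearObs Nf x (Matrix.single g f (1 : ℂ)) gammaFive).onTorus S v U =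
      ∑ p : Fin 3 × Fin 4, (![1, 1, -1, -1] : Fin 4 → ℂ) p.2 •
        (qbar (g, (Torus.proj S ((x : Literature.Probability.LatticeModels.Site 4) + v), p.1, p.2)) *
          q (f, (Torus.proj S ((x : Literature.Probability.LatticeModels.Site 4) + v), p.1, p.2))) := by
  rw [localBilinearObs_onTorus]
  simp only [Matrix.single_apply, ite_and, ite_smul, one_smul, zero_smul, Finset.sum_ite_irrel,
    Finset.sum_const_zero, Finset.sum_ite_eq, Finset.mem_univ, if_true]
  rw [gammaFive_eq_diagonal, torusBilinear_diagonal_one, Fintype.sum_prod_type]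

/-! ### The multi-meson observables and their Berezin ratio -/

/-- The multi-meson `Π_a (ψ̄_g γ₅ ψ_f)(x_a)` has `U(1)_f` charge `r`. -/
theorem isFlavourCharged_multiMesonObs {Nf R r : ℕ} {f g : Fin Nf} (hfg : f ≠ g)
    (x : Fin r → ↥(box 4 R)) : (List.ofFn fun a => localBilinearObs Nf (x a) (Matrix.single g f (1 : ℂ)) gammaFive).prod.IsFlavourCharged f (r : ℤ) := by
  have h := QCDLatticeObservable.IsFlavourCharged.ofFn_prod
    (fun a => localBilinearObs Nf (x a) (Matrix.single g f (1 : ℂ)) gammaFive) (fun _ => (1 : ℤ))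
    fun a => isFlavourCharged_localBilinearObs_single (x a) hfg
  simpa using h

/-- **The multi-meson placed at `v`, expanded**: `Σ_{P : Fin r → colour × spin} (Πε(P)) • Π_a ψ̄_g(I_a) ψ_f(I_a)`
with `I_a = ((x_a + v) mod S, P_a)`. -/
theorem multiMesonObs_onTorus {Nf R r S : ℕ} [NeZero S] (g f : Fin Nf) (x : Fin r → ↥(box 4 R))
    (v : Literature.Probability.LatticeModels.Site 4) (U : GaugeConfig 4 S SU3) :
    (List.ofFn fun a => localBilinearObs Nf (x a) (Matrix.single g f (1 : ℂ)) gammaFive).prod.onTorus S v U =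
      ∑ P : Fin r → Fin 3 × Fin 4, (∏ a, (![1, 1, -1, -1] : Fin 4 → ℂ) (P a).2) •
        (List.ofFn fun a =>
          qbar (g, (Torus.proj S ((x a : Literature.Probability.LatticeModels.Site 4) + v), (P a).1, (P a).2)) *
            q (f, (Torus.proj S ((x a : Literature.Probability.LatticeModels.Site 4) + v), (P a).1, (P a).2))).prod := by
  rw [QCDLatticeObservable.onTorus_ofFn_prod]
  simp only [localBilinearObs_single_onTorus_eq_sum]
  rw [ofFn_prod_sum]
  refine Finset.sum_congr rfl fun P _ => ?_
  rw [ofFn_prod_smul]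

/-- **The Berezin ratio of the multi-meson pair is `σ_r` times the colour–spin sum of squared Wick
minors**, in every gauge background (junk-consistent for `det D = 0` when `r ≥ 1`). -/
theorem multiMesonPair_fermiRatio_eq {Nf R r S : ℕ} [NeZero S] {f g : Fin Nf} (hfg : f ≠ g)
    (hr : 0 < r) (x y : Fin r → ↥(box 4 R)) (v w : Literature.Probability.LatticeModels.Site 4)
    (U : GaugeConfig 4 S SU3) (mq : Fin Nf → ℝ) (hm : mq f = mq g)
    (σ : ℂ) (hσ : ∀ (Nf L : ℕ) [NeZero L] (U : GaugeConfig 4 L SU3) (mq : Fin Nf → ℝ) (f g : Fin Nf),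
      f ≠ g → mq f = mq g → (diracMatrix U mq).det ≠ 0 →
        ∀ (I J : Fin r → TorusSite 4 L × Fin 3 × Fin 4),
          fermiIntegral ((List.ofFn fun a : Fin r => qbar (g, I a) * q (f, I a)).prod *
              (List.ofFn fun b : Fin r => qbar (f, J b) * q (g, J b)).prod * fermiBoltzmann U mq) /
            fermiIntegral (fermiBoltzmann U mq) =
          σ * (∏ a, (![1, 1, -1, -1] : Fin 4 → ℂ) (I a).2.2) * (∏ b, (![1, 1, -1, -1] : Fin 4 → ℂ) (J b).2.2) *
            (((‖(Matrix.of fun a b : Fin r => (diracMatrix U mq)⁻¹ (quarkEquiv (f, I a)) (quarkEquiv (f, J b))).det‖ ^ 2 : ℝ) : ℂ))) :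
    fermiIntegral ((List.ofFn fun a => localBilinearObs Nf (x a) (Matrix.single g f (1 : ℂ)) gammaFive).prod.onTorus S v U * (List.ofFn fun b => localBilinearObs Nf (y b) (Matrix.single f g (1 : ℂ)) gammaFive).prod.onTorus S w U *
        fermiBoltzmann U mq) / fermiIntegral (fermiBoltzmann U mq) =
      σ * (((∑ P : Fin r → Fin 3 × Fin 4, ∑ Q : Fin r → Fin 3 × Fin 4,
        ‖(Matrix.of fun a b : Fin r => (diracMatrix U mq)⁻¹
          (quarkEquiv (f, (Torus.proj S ((x a : Literature.Probability.LatticeModels.Site 4) + v), (P a).1, (P a).2)))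
          (quarkEquiv (f, (Torus.proj S ((y b : Literature.Probability.LatticeModels.Site 4) + w), (Q b).1, (Q b).2)))).det‖ ^ 2 : ℝ) : ℂ)) := by
  by_cases hD : (diracMatrix U mq).det = 0
  · -- junk case: `Z_F = 0`, `D⁻¹ = 0`, and an `r × r` zero determinant with `r ≥ 1` vanishes
    have hZ : fermiIntegral (fermiBoltzmann U mq) = 0 := by
      rw [fermiIntegral_fermiBoltzmann, hD, mul_zero]
    have hinv : (diracMatrix U mq)⁻¹ = 0 :=
      Matrix.nonsing_inv_apply_not_isUnit _ (by rw [hD]; exact not_isUnit_zero)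
    haveI : Nonempty (Fin r) := ⟨⟨0, hr⟩⟩
    have hdet : ∀ (I J : Fin r → FermiIdx Nf S),
        (Matrix.of fun a b : Fin r => (diracMatrix U mq)⁻¹ (I a) (J b)).det = 0 := by
      intro I J
      rw [hinv]
      exact Matrix.det_eq_zero_of_column_eq_zero ⟨0, hr⟩ fun a => rfl
    rw [hZ, div_zero]
    simp [hdet]
  -- invertible case: expand both multi-mesons and apply the rank-r Wick identity termwise
  rw [multiMesonObs_onTorus, multiMesonObs_onTorus]
  simp only [Finset.sum_mul, Finset.mul_sum, smul_mul_assoc, mul_smul_comm, map_sum, map_smul,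
    smul_eq_mul, Finset.sum_div, mul_div_assoc]
  -- the expansion puts the `B`-index outermost; swap so that the outer index is the `A`-side one
  conv_lhs => rw [Finset.sum_comm]
  rw [Complex.ofReal_sum, Finset.mul_sum]
  refine Finset.sum_congr rfl fun P _ => ?_
  rw [Complex.ofReal_sum, Finset.mul_sum]
  refine Finset.sum_congr rfl fun Q _ => ?_
  rw [hσ Nf S U mq f g hfg hm hD
    (fun a => (Torus.proj S ((x a : Literature.Probability.LatticeModels.Site 4) + v), (P a).1, (P a).2))
    (fun b => (Torus.proj S ((y b : Literature.Probability.LatticeModels.Site 4) + w), (Q b).1, (Q b).2))]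
  dsimp only
  have hP := prod_gammaFiveSign_mul_self fun a => (P a).2
  have hQ := prod_gammaFiveSign_mul_self fun b => (Q b).2
  set eP := ∏ a, (![1, 1, -1, -1] : Fin 4 → ℂ) (P a).2
  set eQ := ∏ b, (![1, 1, -1, -1] : Fin 4 → ℂ) (Q b).2
  set X := (((‖(Matrix.of fun a b : Fin r => (diracMatrix U mq)⁻¹
      (quarkEquiv (f, (Torus.proj S ((x a : Literature.Probability.LatticeModels.Site 4) + v), (P a).1, (P a).2)))
      (quarkEquiv (f, (Torus.proj S ((y b : Literature.Probability.LatticeModels.Site 4) + w), (Q b).1, (Q b).2)))).det‖ ^ 2 : ℝ) : ℂ))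
  linear_combination (σ * X * eQ * eQ) * hP + (σ * X) * hQ

/-- W11: RANK-r NECESSITY — the crux contains the uniform bound and e₀-decay of the phase-quenched SECOND moments of all r × r Wick minors of a doubled flavour (colour–spin summed), via the multi-meson pair Π(ψ̄_g γ₅ ψ_f)(x_a), Π(ψ̄_f γ₅ ψ_g)(y_b) and the rank-r Wick identity p142089. -/
theorem stub_doubletMinorSecondMoment_of_crux :
    Summit.QuantumFields.QCD.Theses.PauliWegnerSea.PhaseQuenchedFlavourDecay → ∀ (Nf : ℕ) (reg : QCDRegularisation Nf) (m : Fin Nf → ℝ), (∀ f, 0 < m f) → ∀ (f g : Fin Nf), f ≠ g → m f = m g → (∃ s δ C : ℝ, 0 < s ∧ s < 1 ∧ 0 < δ ∧ ∀ᶠ k in atTop, ∀ S : ℕ, reg.L k ≤ S → ∀ (f : Fin Nf) (v : Literature.Probability.LatticeModels.Site 4), v ∈ box 4 S → (∫ U : GaugeConfig 4 (2 * S + 1) (Matrix.specialUnitaryGroup (Fin 3) ℂ), ‖(diracMatrix U fun fl => reg.mcrit k + reg.a k * m fl / reg.Zm k).det‖ * (∑ a : Fin 3, ∑ i : Fin 4,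 ∑ b : Fin 3, ∑ j : Fin 4, ‖(diracMatrix U fun fl => reg.mcrit k + reg.a k * m fl / reg.Zm k)⁻¹ (quarkEquiv (f, (Torus.proj (2 * S + 1) 0, a, i))) (quarkEquiv (f, (Torus.proj (2 * S + 1) (v), b, j)))‖) ^ s ∂(wilsonMeasure (fundamentalRep (Fin 3)) (reg.β k))) / (∫ U : GaugeConfig 4 (2 * S + 1) (Matrix.specialUnitaryGroup (Fin 3) ℂ), ‖(diracMatrix U fun fl => reg.mcrit k + reg.a k * m fl / reg.Zm k).det‖ ∂(wilsonMeasure (fundamentalRep (Fin 3)) (reg.β k))) ≤ C * Real.exp (-(δ * (reg.a k * ‖v‖)))) → ∃ δ' : ℝ, 0 < δ' ∧ ∀ (r R : ℕ), 0 < r → ∀ (x y : Fin r → ↥(box 4 R)), ∃ C' : ℝ, ∀ᶠ k in atTop, ∀ S : ℕ, reg.L k ≤ S → ∀ n : ℕ, n ≤ S → qcdPhaseQuenchedExpect (reg.β k) (2 * S + 1) (fun fl => reg.mcrit k + reg.a k * m fl / reg.Zm k) (fun U : GaugeConfig 4 (2 * S + 1) SU3 => ∑ P : Fin r → Fin 3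 × Fin 4, ∑ Q : Fin r → Fin 3 × Fin 4, ‖(Matrix.of fun a b : Fin r => (diracMatrix U fun fl => reg.mcrit k + reg.a k * m fl / reg.Zm k)⁻¹ (quarkEquiv (f, (Torus.proj (2 * S + 1) (x a : Literature.Probability.LatticeModels.Site 4), (P a).1, (P a).2))) (quarkEquiv (f, (Torus.proj (2 * S + 1) ((y b : Literature.Probability.LatticeModels.Site 4) + Pi.single 0 (n : ℤ)), (Q b).1, (Q b).2)))).det‖ ^ (2 : ℕ)) ≤ C' * Real.exp (-(δ' * (reg.a k * n))) := by
  intro hcrux Nf reg m hm f g hfg hfgm hUp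
  obtain ⟨δ', hδ', hC⟩ := hcrux Nf reg m hm hUp
  refine ⟨δ', hδ', fun r R hr x y => ?_⟩
  obtain ⟨σ, hσ1, hσ⟩ := stub_doubletMinorSquare_wick r
  have hσn : ‖σ‖ = 1 := by rcases hσ1 with h | h <;> simp [h]
  have hq : (r : ℤ) ≠ 0 := by exact_mod_cast hr.ne'
  obtain ⟨C', hk⟩ := hC R R (List.ofFn fun a => localBilinearObs Nf (x a) (Matrix.single g f (1 : ℂ)) gammaFive).prod (List.ofFn fun b => localBilinearObs Nf (y b) (Matrix.single f g (1 : ℂ)) gammaFive).prod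
    ⟨f, r, hq, isFlavourCharged_multiMesonObs hfg x⟩
  refine ⟨C', ?_⟩
  filter_upwards [hk] with k hk S hS n hn
  have key := hk S hS n hn
  set mq : Fin Nf → ℝ := fun fl => reg.mcrit k + reg.a k * m fl / reg.Zm k with hmqdef
  have hmq : mq f = mq g := by simp only [hmqdef, hfgm]
  have hpt : ∀ U : GaugeConfig 4 (2 * S + 1) SU3,
      fermiIntegral ((List.ofFn fun a => localBilinearObs Nf (x a) (Matrix.single g f (1 : ℂ)) gammaFive).prod.onTorus (2 * S + 1) 0 U *
            (List.ofFn fun b => localBilinearObs Nf (y b) (Matrix.single f g (1 : ℂ)) gammaFive).prod.onTorus (2 * S + 1) (Pi.single 0 (n : ℤ)) U *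
          fermiBoltzmann U mq) / fermiIntegral (fermiBoltzmann U mq) =
        σ * (((∑ P : Fin r → Fin 3 × Fin 4, ∑ Q : Fin r → Fin 3 × Fin 4,
          ‖(Matrix.of fun a b : Fin r => (diracMatrix U mq)⁻¹
            (quarkEquiv (f, (Torus.proj (2 * S + 1) (x a : Literature.Probability.LatticeModels.Site 4), (P a).1, (P a).2)))
            (quarkEquiv (f, (Torus.proj (2 * S + 1) ((y b : Literature.Probability.LatticeModels.Site 4) + Pi.single 0 (n : ℤ)), (Q b).1, (Q b).2)))).det‖ ^ 2 : ℝ) : ℂ)) := by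
    intro U
    have h := multiMesonPair_fermiRatio_eq (S := 2 * S + 1) hfg hr x y 0 (Pi.single 0 (n : ℤ)) U mq hmq σ hσ
    simpa only [add_zero] using h
  rw [← qcdPhaseQuenchedExpect_eq_div_complex, qcdPhaseQuenchedExpect_eq_integral_qcdLatticeMeasure] at key
  simp only [hpt] at key
  rw [integral_const_mul, integral_complex_ofReal, norm_mul, hσn, one_mul, Complex.norm_real,
    Real.norm_eq_abs] at key
  rw [qcdPhaseQuenchedExpect_eq_integral_qcdLatticeMeasure]
  exact (le_abs_self _).trans key

end Summit.QuantumFields.QCD.Cruxes.PhaseQuenchedFlavourDecay.CrossingSplitIntegrability
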